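import Literature.Topology.FourManifolds.MMSWRasmussenFacts
import Literature.Topology.FourManifolds.HomotopyBallSlice
import Mathlib.Topology.Homotopy.Equiv
import HarnessLib

/-!
# Sketch — crux-ideate stmt-SmoothPoincare4-16151 (DcrRasmussenWitness), round 1, ideator 2

First lemmas of the three idea cards, typed over existing declarations
(`Literature.Topology.FourManifolds.MMSW.*`, `MMSWRasmussen`, `Knot`, `Knot.IsHomotopyBallSlice`,
`Knot.HasRasmussenInvariant`, `Knot.HasGaussDiagram`, `GaussDiagram.nMinus`).
`CruxSig` is the item's signature verbatim (set by refuter-rattack-…-16151-0, 2026-08-16).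
-/

open scoped Manifold ContDiff Topology
open Function Set ContinuousMap

noncomputable section

namespace Summit.SmoothPoincare4.SmoothPoincare4.Cruxes.DcrRasmussenWitness.Sketch

open Literature.Topology.FourManifolds
open Literature.Topology.FourManifolds.MMSW

/-- Local notation: `𝔼 n` is the model Euclidean space `EuclideanSpace ℝ (Fin n)`. -/
local notation "𝔼 " n:arg => EuclideanSpace ℝ (Fin n)

/-- Local notation: `𝕊 n` is the unit sphere in `EuclideanSpace ℝ (Fin (n + 1))`. -/
local notation "𝕊 " n:arg => (Metric.sphere (0 : EuclideanSpace ℝ (Fin (n + 1))) 1)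

/-- The crux `DcrRasmussenWitness`, verbatim (item stmt-SmoothPoincare4-16151). -/
def CruxSig : Prop :=
  ∃ k : ℕ, 1 ≤ k ∧ ∃ K : (𝕊 1) → 𝔼 4, IsModelKnot k K ∧ IsNullHomologous k K ∧
    (∃ (M : Type) (_ : TopologicalSpace M) (_ : T2Space M) (_ : SecondCountableTopology M)
      (_ : ChartedSpace (𝔼 4) M) (_ : IsManifold (𝓡 4) ((⊤ : ℕ∞) : WithTop ℕ∞) M),
      Nonempty (M ≃ₕ (𝕊 4)) ∧ ∃ (e : 𝔼 4 → M) (f : 𝔼 2 → M), IsSliceDiscInComplement k K M e f) ∧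
    ∃ w : MMSWRasmussen k K, 0 < w.sMinus ∨ w.sPlus < 0

/-- The certificate clause of the crux: `s₋(K) > 0 ∨ s₊(K) < 0`. -/
def HasCertificate (k : ℕ) (K : 𝕊 1 → 𝔼 4) : Prop :=
  ∃ w : MMSWRasmussen k K, 0 < w.sMinus ∨ w.sPlus < 0

/-! ## Card `dotted-rbg-generator` — first lemma: the certificate clause is mirror-blind

The dotted zero-surgery transfer hands the knot `K_G` to a complement `V'` whose boundary is
`M_k` with the OPPOSITE orientation, i.e. the model mirror `ρ ∘ K_G`; the OR-form of the
certificate makes this harmless (`s_±(ρK) = -s_∓(K)`, MMSW Prop. 8.8 (1)). PROVED. -/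

/-- Forward: a certificate for `K` is a certificate for `ρ ∘ K`. -/
theorem HasCertificate.modelMirror {k : ℕ} {K : 𝕊 1 → 𝔼 4} (h : HasCertificate k K) :
    HasCertificate k (MMSW.modelMirror ∘ K) := by
  obtain ⟨w, hw⟩ := h
  refine ⟨w.modelMirror, ?_⟩
  rcases hw with hw | hw
  · right
    rw [MMSWRasmussen.sPlus_modelMirror]
    omega
  · left
    rw [MMSWRasmussen.sMinus_modelMirror]
    omega

/-- **Mirror invariance of the certificate clause.** -/
theorem hasCertificate_modelMirror_iff (k : ℕ) (K : 𝕊 1 → 𝔼 4) :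
    HasCertificate k (MMSW.modelMirror ∘ K) ↔ HasCertificate k K := by
  refine ⟨fun h ↦ ?_, HasCertificate.modelMirror⟩
  have h2 := h.modelMirror
  have hρρ : MMSW.modelMirror ∘ (MMSW.modelMirror ∘ K) = K :=
    funext fun t ↦ MMSW.modelMirror_modelMirror (K t)
  rwa [hρρ] at h2

/-! ## Card `knotified-bit-certificates` — first lemma: local knots collapse to `k = 0`

A model knot inside the ball `{‖x‖ < 2} ∩ ∂D_k` (no hole, no core circle there: `|z| < 2`,
`|w|² = 1 - g(z) > 0.9`) that bounds a disc in the complement `Σ ∖ e(D_k)` of the dotted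
handlebody in a homotopy 4-sphere bounds a disc in the homotopy ball `Σ°` (attach the `k`
`1`-handles of `e(D_k)` back: `3`-handles from the complement's side, along belt spheres the
knot misses — Davis–Nagel–Park–Ray arXiv:1707.04542 Prop. 2.x for `Σ = S⁴`). Its `S³`-type is
the standard picture `D(0⃗) = finiteApprox k 0 K` (MMSW Ex. 8.3: `s₋ = s₊ = s`). NOT proved here
(line lemma). -/

/-- A **local** model knot: image in the ball `{‖x‖ < 2}` of `∂D_k`. -/
def IsLocal (K : 𝕊 1 → 𝔼 4) : Prop := ∀ t, ‖K t‖ < 2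

/-- **Collapse base**: a local model knot sliced in the dotted complement of a homotopy sphere
is slice in a homotopy ball (as the `S³`-knot `D(0⃗)`). -/
theorem isHomotopyBallSlice_of_isLocal_of_isSliceDiscInComplement (k : ℕ) (K : 𝕊 1 → 𝔼 4)
    (M : Type) [TopologicalSpace M] [T2Space M] [SecondCountableTopology M]
    [ChartedSpace (𝔼 4) M] [IsManifold (𝓡 4) ∞ M] [CompactSpace M]
    (e : 𝔼 4 → M) (f : 𝔼 2 → M) (K₀ : Knot)
    (hK : IsModelKnot k K) (hloc : IsLocal K) (hM : Nonempty (M ≃ₕ (𝕊 4)))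
    (hf : IsSliceDiscInComplement k K M e f) (hK₀ : ⇑K₀ = finiteApprox k 0 K) :
    K₀.IsHomotopyBallSlice := by
  sorry

/-- **Converse embedding** (`k = 0` certificates are dotted certificates): an FGMW witness —
an `S³`-knot slice in a homotopy ball with `s ≠ 0` — gives the crux with `k = 1` (place the knot
in the ball `{‖x‖ < 2}` of `∂D_1`; MMSW Ex. 8.3). Stated modulo the two MMSW existence facts. -/
theorem cruxSig_of_fgmw0 (hgp : MMSW.exists_isModelIsotopic_wC_ne_zero)
    (hev : MMSW.eventually_approxHasRasmussen)
    (h : ∃ K₀ : Knot, K₀.IsHomotopyBallSlice ∧ ∃ s : ℤ, K₀.HasRasmussenInvariant s ∧ s ≠ 0) :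
    CruxSig := by
  sorry

/-! ## Card `certified-first-closing` — first lemma: MMSW Conjecture 8.31 makes positivity a free certificate -/

/-- **MMSW Conjecture 8.31 (knot case, standard picture).** If the standard picture
`D(0⃗) = finiteApprox k 0 K` of the null-homologous model knot `K ⊂ ∂D_k` is a POSITIVE diagram
(`n⁻ = 0` for a Gauss diagram it reads), then `s₋(K) = s(D(0⃗))` — the monotone sequence
`s(D(k⃗))` (MMSW Prop. 8.2) is constant from `k = 0` on. (MMSW prove `s₋ ≤ s(D₀) ≤ s₊`,
Thm. 8.28; equality is their Conj. 8.31 with `s(D₀) = n⁺ - O + 1`, eq. (8.5).) -/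
def Conjecture831 : Prop :=
  ∀ (k : ℕ) (K : 𝕊 1 → 𝔼 4) (s s₀ : ℤ) (K₀ : Knot) (G : GaussDiagram),
    HasSMinus k K s → (⇑K₀ = finiteApprox k 0 K) → K₀.HasGaussDiagram G → G.nMinus = 0 →
      K₀.HasRasmussenInvariant s₀ → s = s₀

/-- **Positivity ⇒ certificate, given Conjecture 8.31**: a null-homologous model knot whose
standard picture is a positive diagram of a knot with `s > 0` (e.g. any non-trivial positive
knot type) carries the certificate `s₋(K) > 0` — no Khovanov computation in `#ᵏ(S¹ × S²)`.
PROVED from the named facts. -/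
theorem hasCertificate_of_positive_picture (h831 : Conjecture831)
    (hgp : MMSW.exists_isModelIsotopic_wC_ne_zero) (hev : MMSW.eventually_approxHasRasmussen)
    (huniq : MMSW.hasSMinus_unique) {k : ℕ} {K : 𝕊 1 → 𝔼 4} {s₀ : ℤ} {K₀ : Knot}
    {G : GaussDiagram} (hK : IsModelKnot k K) (h0 : IsNullHomologous k K)
    (hK₀ : ⇑K₀ = finiteApprox k 0 K) (hG : K₀.HasGaussDiagram G) (hpos : G.nMinus = 0)
    (hs₀ : K₀.HasRasmussenInvariant s₀) (hs₀pos : 0 < s₀) : HasCertificate k K := by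
  obtain ⟨w⟩ := (MMSWRasmussen.nonempty_iff hgp hev).2 ⟨hK, h0⟩
  have hw : w.sMinus = s₀ := h831 k K w.sMinus s₀ K₀ G w.hasSMinus hK₀ hG hpos hs₀
  exact ⟨w, Or.inl (by omega)⟩

/-- The crux from a positive-picture witness (given Conjecture 8.31 and the MMSW facts): it
remains to find `k ≥ 1`, a homotopy sphere and a complement slice disc for such a `K`. -/
theorem cruxSig_of_positive_witness (h831 : Conjecture831)
    (hgp : MMSW.exists_isModelIsotopic_wC_ne_zero) (hev : MMSW.eventually_approxHasRasmussen)
    (huniq : MMSW.hasSMinus_unique)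
    (h : ∃ k : ℕ, 1 ≤ k ∧ ∃ (K : 𝕊 1 → 𝔼 4) (s₀ : ℤ) (K₀ : Knot) (G : GaussDiagram),
      IsModelKnot k K ∧ IsNullHomologous k K ∧ ⇑K₀ = finiteApprox k 0 K ∧
      K₀.HasGaussDiagram G ∧ G.nMinus = 0 ∧ K₀.HasRasmussenInvariant s₀ ∧ 0 < s₀ ∧
      ∃ (M : Type) (_ : TopologicalSpace M) (_ : T2Space M) (_ : SecondCountableTopology M)
        (_ : ChartedSpace (𝔼 4) M) (_ : IsManifold (𝓡 4) ((⊤ : ℕ∞) : WithTop ℕ∞) M),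
        Nonempty (M ≃ₕ (𝕊 4)) ∧ ∃ (e : 𝔼 4 → M) (f : 𝔼 2 → M), IsSliceDiscInComplement k K M e f) :
    CruxSig := by
  obtain ⟨k, hk, K, s₀, K₀, G, hK, h0, hK₀, hG, hpos, hs₀, hs₀pos, hM⟩ := h
  exact ⟨k, hk, K, hK, h0, hM,
    hasCertificate_of_positive_picture h831 hgp hev huniq hK h0 hK₀ hG hpos hs₀ hs₀pos⟩

end Summit.SmoothPoincare4.SmoothPoincare4.Cruxes.DcrRasmussenWitness.Sketch

end
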